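import Summits.Ventures.Crystal3D.Theorems.StickyWulffConstantTextureLiminfTexShadowLevelReach
import Summits.Ventures.Crystal3D.Theorems.StickyWulffConstantCoaxialWallLawPayerEndPairsMultiPlates
import HarnessLib

/-!
# The pooled END PAIRS of several word families LAUNCHED INSIDE THE WINDOW, relaunches counted (level reach, multi-root layer)
# (lane T, crux `TextureLiminfV5`, stmt-Ventures-23912, registered stub `stub_terraceCensus`; (β) terrace census, LevelReach — count half)

HONEST FRAMING. Venture `Summits/Ventures/Crystal3D` (cell `crystal3d-full`), route `route-Ventures-StickyWulffConstant`, helper `--supports`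
the law-v5 crux `TextureLiminfV5` (stmt-Ventures-23912), lane T, mechanism (β) (level ledger; resume records HOME/wall-p1-g19/BETA-LEDGER-RESUME-g19.md
§4(2)/§6 (T2 joint pooling), HOME/wall-p1-g20/BETA-LITE-g20.md rev 4.1 §9).  Census-free, certificate-free; inputs `KissingGap δ`,
`KissingClassification δ` BY NAME exactly as in lane F's multi-root census; nothing about energies is asserted; F-C1 not moved.

THE POINT.  Lane F's `word_endPairs_multi_plates` (…CoaxialWallLawPayerEndPairsMultiPlates) VERBATIM — several roots `r ∈ RT` over ONE base frame
`F []`, each with its own state invariant `P r`, per-family typed end pairs pooled into one set `T` pairwise DISJOINT across roots by LEMMA X in its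
shape form (`word_target_ne_of_roots_ne_shape`), the same CORE `P'` / top plate `P₂` hypotheses root by root — with the families sourced from
root-indexed LAUNCH SETS `L r` inside the window (`word_family_endPairs_launch`, …TexShadowLevelReach) instead of the core: per root, every launch
ball is a legal moving `r`-root state with `p + F [] r ∉ L r` (`hLsrc`, `hLstep`), and the RELAUNCHES of each family are counted in the geometric
form of the family theorem (arriving state at the root-line predecessor `p − F [] r`, in the root class straight, or in a one-letter class `[μ]`
crossing back to the root class).

* **`word_endPairs_multi_launch`** — `Σ_r #{p ∈ L r : first step inside the window} ≤ #T + Σ_r #{relaunched p ∈ L r} + #RT·(220·#rim_top +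
  220·#rim_bottom)`, `T` exported with end ball / predecessor / contact / window, the two-payer dichotomy, and per pair its root `r ∈ RT`, the
  invariant `P r` at the end ball and a moving predecessor with `IsEndMove` — the shape `card_endPairs_le_of_localRow` (…EndRowDischarge) and lane
  F's row certificates consume.  This is the joint pooling (T2) of the (β) ledger across the root classes of ONE frame; pooling across the
  letters' frames is the assembly's business.
WHAT THIS IS NOT: any bound on the relaunch terms, the launch-set supply count, any certificate / energy statement; F-C1 not moved.
-/
noncomputable section

namespace Summit.Ventures.Crystal3D.Theorems

open Summit.Ventures.Crystal3D Finset
open Literature.MathematicalPhysics.StatisticalMechanics (fccStacking)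
open scoped InnerProductSpace

section MultiRootLaunch

variable {X : Finset (EuclideanSpace ℝ (Fin 3))}
  {F : List (EuclideanSpace ℝ (Fin 3)) → (EuclideanSpace ℝ (Fin 3) ≃ₗᵢ[ℝ] EuclideanSpace ℝ (Fin 3))}
  {u : EuclideanSpace ℝ (Fin 3) → List (EuclideanSpace ℝ (Fin 3)) → EuclideanSpace ℝ (Fin 3)}
  {WF : EuclideanSpace ℝ (Fin 3) → List (EuclideanSpace ℝ (Fin 3)) → Prop}
  {next : List (EuclideanSpace ℝ (Fin 3)) → EuclideanSpace ℝ (Fin 3) → List (EuclideanSpace ℝ (Fin 3))}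
  {P' P₂ : Finset (EuclideanSpace ℝ (Fin 3))} {R₀ h ρ : ℝ}

open scoped Classical in
/-- **The multi-root end pairs at version `ver`, launched from root-indexed sets `L r` inside the window, relaunches counted.**  Hypotheses
VERBATIM from `word_endPairs_multi_plates` except that the launch sets (`hLsrc`, `hLstep`) replace the core sources; the relaunch term of root
`r` is that of `word_family_endPairs_launch` for the family `(F, u r, WF r, next, P r)` with `F [] (u r []) = F [] r`.  See the module docstring. -/
theorem word_endPairs_multi_launch (ver : WordVersion) {δ : ℝ} (hg : KissingGap δ) (hc : KissingClassification δ)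
    (hX : ∀ p ∈ X, ∀ q ∈ X, p ≠ q → 1 ≤ dist p q)
    (hFc : ∀ μ κ, F (μ :: κ) = ((ℝ ∙ μ)ᗮ.reflection).trans (F κ))
    (RT : Finset (EuclideanSpace ℝ (Fin 3))) (hRT : ∀ r ∈ RT, r ∈ fccSlots)
    (hu0 : ∀ r ∈ RT, u r [] = r) (huc : ∀ r ∈ RT, ∀ μ κ, u r (μ :: κ) = -u r κ)
    (hWF0 : ∀ r ∈ RT, WF r [])
    (hWFc : ∀ r ∈ RT, ∀ μ κ, WF r (μ :: κ) ↔ (WF r κ ∧ ‖μ‖ = 1 ∧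
      (∀ w ∈ fccSlots, ⟪w, μ⟫_ℝ = 0 ∨ ⟪w, μ⟫_ℝ = Real.sqrt (2 / 3) ∨ ⟪w, μ⟫_ℝ = -Real.sqrt (2 / 3)) ∧
      ⟪u r κ, μ⟫_ℝ = Real.sqrt (2 / 3) ∧ ∀ μ' κ', κ = μ' :: κ' → μ' ≠ -μ))
    (hnext_pop : ∀ μ κ' (m : EuclideanSpace ℝ (Fin 3)), (F (μ :: κ')).symm m = -μ → next (μ :: κ') m = κ')
    (hnext_push : ∀ κ (m : EuclideanSpace ℝ (Fin 3)), (∀ μ κ', κ = μ :: κ' → (F κ).symm m ≠ -μ) →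
      next κ m = (F κ).symm m :: κ)
    -- the root-indexed state invariants (preserved by LEGAL moves) and the top exclusion
    {P : EuclideanSpace ℝ (Fin 3) → EuclideanSpace ℝ (Fin 3) × List (EuclideanSpace ℝ (Fin 3)) → Prop}
    (hPstraight : ∀ r ∈ RT, ∀ (b : EuclideanSpace ℝ (Fin 3)) (κ : List (EuclideanSpace ℝ (Fin 3))), WF r κ →
      (IsFull X (F κ) b ∨ (∃ m, IsTwinReading X (F κ) m b ∧ ⟪F κ (u r κ), m⟫_ℝ = 0) ∨
        (ver = WordVersion.v2 ∧ IsNarrow X (F κ) (F κ (u r κ)) b)) →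
      P r (b, κ) → P r (b + F κ (u r κ), κ))
    (hPcross : ∀ r ∈ RT, ∀ (b : EuclideanSpace ℝ (Fin 3)) (κ : List (EuclideanSpace ℝ (Fin 3)))
      (m : EuclideanSpace ℝ (Fin 3)), WF r κ → WF r (next κ m) → IsTwinReading X (F κ) m b →
      ⟪F κ (u r κ), m⟫_ℝ = Real.sqrt (2 / 3) → P r (b, κ) → P r (b + F (next κ m) (u r (next κ m)), next κ m))
    (hPexcl0 : ∀ r ∈ RT, ∀ (b : EuclideanSpace ℝ (Fin 3)) (κ : List (EuclideanSpace ℝ (Fin 3))), WF r κ → P r (b, κ) →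
      b ∈ P₂ →
      (∃ a ∈ fccSlots, ∃ a' ∈ fccSlots, ∃ a'' ∈ fccSlots,
        ⟪a, a'⟫_ℝ = 1 / 2 ∧ ⟪a, a''⟫_ℝ = 1 / 2 ∧ ⟪a', a''⟫_ℝ = 1 / 2 ∧
        b + F κ a ∈ X ∧ b + F κ a' ∈ X ∧ b + F κ a'' ∈ X) → False)
    (hup : ∀ r ∈ RT, 0 < (F [] r) 2)
    -- the cell
    (hR₀ : 3 ≤ R₀) (hρ : R₀ ≤ ρ)
    -- the root-indexed LAUNCH SETS: legal moving root states, first step off the launch set, invariant started at the first step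
    (L : EuclideanSpace ℝ (Fin 3) → Finset (EuclideanSpace ℝ (Fin 3)))
    (hLsrc : ∀ r ∈ RT, ∀ p ∈ L r, p ∈ X ∧
      (∃ a ∈ fccSlots, ∃ a' ∈ fccSlots, ∃ a'' ∈ fccSlots,
        ⟪a, a'⟫_ℝ = 1 / 2 ∧ ⟪a, a''⟫_ℝ = 1 / 2 ∧ ⟪a', a''⟫_ℝ = 1 / 2 ∧
        p + F [] a ∈ X ∧ p + F [] a' ∈ X ∧ p + F [] a'' ∈ X) ∧
      p - F [] r ∈ X ∧
      (IsFull X (F []) p ∨ (∃ m, IsTwinReading X (F []) m p ∧ ⟪F [] r, m⟫_ℝ = 0) ∨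
        (ver = WordVersion.v2 ∧ IsNarrow X (F []) (F [] r) p)) ∧
      P r (p + F [] r, []))
    (hLstep : ∀ r ∈ RT, ∀ p ∈ L r, p + F [] r ∉ L r)
    -- the bottom plate's CORE: below the window, rigid root by root, sealed; the top plate's sealing
    (hP'top : ∀ p ∈ P', p 2 ≤ -R₀ - 1)
    (hstd : ∀ r ∈ RT, ∀ κ, WF r κ → ∀ p ∈ P', (∃ a ∈ fccSlots, ∃ a' ∈ fccSlots, ∃ a'' ∈ fccSlots,
        ⟪a, a'⟫_ℝ = 1 / 2 ∧ ⟪a, a''⟫_ℝ = 1 / 2 ∧ ⟪a', a''⟫_ℝ = 1 / 2 ∧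
        p + F κ a ∈ X ∧ p + F κ a' ∈ X ∧ p + F κ a'' ∈ X) → F κ (u r κ) = F [] r)
    (hsealB : ∀ s ∈ X, s ∉ P' → -R₀ - 1 - 1 ≤ s 2 → s 2 < -R₀ - 1 → s 0 ^ 2 + s 1 ^ 2 ≤ (ρ - 1) ^ 2 → False)
    (hP₂seal : ∀ s ∈ X, h + R₀ + 1 ≤ s 2 → s 2 ≤ h + R₀ + 1 + 1 → s 0 ^ 2 + s 1 ^ 2 ≤ (ρ - 2) ^ 2 → s ∈ P₂) :
    ∃ T : Finset (EuclideanSpace ℝ (Fin 3) × EuclideanSpace ℝ (Fin 3)),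
      ∑ r ∈ RT, ((L r).filter fun p => -R₀ - 1 < (p + F [] r) 2 ∧ (p + F [] r) 2 < h + R₀ + 1).card ≤
        T.card +
        ∑ r ∈ RT, ((L r).filter fun p => P r (p - F [] r, []) ∧
            -R₀ - 1 ≤ (p - F [] r) 2 ∧ (p - F [] r) 2 < h + R₀ + 1 ∧
            (IsFull X (F []) (p - F [] r) ∨
              (∃ m, IsTwinReading X (F []) m (p - F [] r) ∧ ⟪F [] r, m⟫_ℝ = 0) ∨
              (ver = WordVersion.v2 ∧ IsNarrow X (F []) (F [] r) (p - F [] r))) ∨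
          ∃ μ, WF r [μ] ∧ P r (p - F [] r, [μ]) ∧
            -R₀ - 1 ≤ (p - F [] r) 2 ∧ (p - F [] r) 2 < h + R₀ + 1 ∧
            ∃ m, IsTwinReading X (F [μ]) m (p - F [] r) ∧
              ⟪F [μ] (u r [μ]), m⟫_ℝ = Real.sqrt (2 / 3) ∧ next [μ] m = []).card +
        RT.card *
          (220 * (X.filter fun s => h + R₀ + 1 ≤ s 2 ∧ s 2 ≤ h + R₀ + 1 + 1 ∧ (ρ - 2) ^ 2 < s 0 ^ 2 + s 1 ^ 2).card +
           220 * (X.filter fun s => -R₀ - 1 - 1 ≤ s 2 ∧ s 2 < -R₀ - 1 ∧ (ρ - 1) ^ 2 < s 0 ^ 2 + s 1 ^ 2).card) ∧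
      (∀ bq ∈ T, bq.1 ∈ X ∧ bq.2 ∈ X ∧ dist bq.1 bq.2 = 1 ∧ -R₀ - 1 ≤ bq.1 2 ∧ bq.1 2 < h + R₀ + 1) ∧
      (∀ bq ∈ T, (X.filter fun q => dist bq.1 q = 1).card ≤ 11 ∨
        ∃ z₁ ∈ X, ∃ z₂ ∈ X, z₁ ≠ z₂ ∧ dist bq.1 z₁ = 1 ∧ dist bq.1 z₂ = 1 ∧
          (X.filter fun q => dist z₁ q = 1).card ≤ 11 ∧ (X.filter fun q => dist z₂ q = 1).card ≤ 11) ∧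
      (∀ bq ∈ T, ∃ r ∈ RT, (∃ κ, WF r κ ∧ P r (bq.1, κ)) ∧
        ∃ κ, WF r κ ∧ bq.2 - F κ (u r κ) ∈ X ∧ IsEndMove X ver (F κ) (F κ (u r κ)) bq.2 bq.1) := by
  set RIM : ℕ :=
    220 * (X.filter fun s => h + R₀ + 1 ≤ s 2 ∧ s 2 ≤ h + R₀ + 1 + 1 ∧ (ρ - 2) ^ 2 < s 0 ^ 2 + s 1 ^ 2).card +
      220 * (X.filter fun s => -R₀ - 1 - 1 ≤ s 2 ∧ s 2 < -R₀ - 1 ∧ (ρ - 1) ^ 2 < s 0 ^ 2 + s 1 ^ 2).card with hRIM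
  -- the per-root relaunch counts
  set REL : EuclideanSpace ℝ (Fin 3) → ℕ := fun r => ((L r).filter fun p => P r (p - F [] r, []) ∧
      -R₀ - 1 ≤ (p - F [] r) 2 ∧ (p - F [] r) 2 < h + R₀ + 1 ∧
      (IsFull X (F []) (p - F [] r) ∨
        (∃ m, IsTwinReading X (F []) m (p - F [] r) ∧ ⟪F [] r, m⟫_ℝ = 0) ∨
        (ver = WordVersion.v2 ∧ IsNarrow X (F []) (F [] r) (p - F [] r))) ∨
    ∃ μ, WF r [μ] ∧ P r (p - F [] r, [μ]) ∧
      -R₀ - 1 ≤ (p - F [] r) 2 ∧ (p - F [] r) 2 < h + R₀ + 1 ∧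
      ∃ m, IsTwinReading X (F [μ]) m (p - F [] r) ∧
        ⟪F [μ] (u r [μ]), m⟫_ℝ = Real.sqrt (2 / 3) ∧ next [μ] m = []).card with hREL
  -- the per-family end pairs, each family with its own invariant `P r` and its own launch set `L r`
  have hfam : ∀ r ∈ RT, ∃ T : Finset (EuclideanSpace ℝ (Fin 3) × EuclideanSpace ℝ (Fin 3)),
      ((L r).filter fun p => -R₀ - 1 < (p + F [] r) 2 ∧ (p + F [] r) 2 < h + R₀ + 1).card ≤ T.card + REL r + RIM ∧
      (∀ bq ∈ T, bq.1 ∈ X ∧ bq.2 ∈ X ∧ dist bq.1 bq.2 = 1 ∧ -R₀ - 1 ≤ bq.1 2 ∧ bq.1 2 < h + R₀ + 1) ∧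
      (∀ bq ∈ T, (X.filter fun q => dist bq.1 q = 1).card ≤ 11 ∨
        ∃ z₁ ∈ X, ∃ z₂ ∈ X, z₁ ≠ z₂ ∧ dist bq.1 z₁ = 1 ∧ dist bq.1 z₂ = 1 ∧
          (X.filter fun q => dist z₁ q = 1).card ≤ 11 ∧ (X.filter fun q => dist z₂ q = 1).card ≤ 11) ∧
      (∀ bq ∈ T, ∃ κ, WF r κ ∧ P r (bq.1, κ)) ∧
      (∀ bq ∈ T, ∃ κ, WF r κ ∧ bq.2 - F κ (u r κ) ∈ X ∧ IsEndMove X ver (F κ) (F κ (u r κ)) bq.2 bq.1) := by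
    intro r hr
    have hur : ∀ κ, u r κ ∈ fccSlots := word_u_mem (hRT r hr) (hu0 r hr) (huc r hr)
    have hup' : 0 < (F [] (u r [])) 2 := by rw [hu0 r hr]; exact hup r hr
    have hLsrc' : ∀ p ∈ L r, p ∈ X ∧
        (∃ a ∈ fccSlots, ∃ a' ∈ fccSlots, ∃ a'' ∈ fccSlots,
          ⟪a, a'⟫_ℝ = 1 / 2 ∧ ⟪a, a''⟫_ℝ = 1 / 2 ∧ ⟪a', a''⟫_ℝ = 1 / 2 ∧
          p + F [] a ∈ X ∧ p + F [] a' ∈ X ∧ p + F [] a'' ∈ X) ∧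
        p - F [] (u r []) ∈ X ∧
        (IsFull X (F []) p ∨ (∃ m, IsTwinReading X (F []) m p ∧ ⟪F [] (u r []), m⟫_ℝ = 0) ∨
          (ver = WordVersion.v2 ∧ IsNarrow X (F []) (F [] (u r [])) p)) ∧
        P r (p + F [] (u r []), []) := by rw [hu0 r hr]; exact hLsrc r hr
    have hLstep' : ∀ p ∈ L r, p + F [] (u r []) ∉ L r := by rw [hu0 r hr]; exact hLstep r hr
    have hstd' : ∀ κ, WF r κ → ∀ p ∈ P', (∃ a ∈ fccSlots, ∃ a' ∈ fccSlots, ∃ a'' ∈ fccSlots,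
        ⟪a, a'⟫_ℝ = 1 / 2 ∧ ⟪a, a''⟫_ℝ = 1 / 2 ∧ ⟪a', a''⟫_ℝ = 1 / 2 ∧
        p + F κ a ∈ X ∧ p + F κ a' ∈ X ∧ p + F κ a'' ∈ X) → F κ (u r κ) = F [] (u r []) := by
      rw [hu0 r hr]; exact hstd r hr
    obtain ⟨T, hkey, hT, hpay, hinv, hwit⟩ := word_family_endPairs_launch ver (F := F) (u := u r) (WF := WF r)
      (next := next) (P := P r) hg hc hX hFc hur (huc r hr) (hWF0 r hr) (hWFc r hr)
      hnext_pop hnext_push (hPstraight r hr) (hPcross r hr) (hPexcl0 r hr) hup' hR₀ hρ (L r) hLsrc' hLstep' hP'top hstd'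
      hsealB hP₂seal
    rw [hu0 r hr] at hkey
    exact ⟨T, by rw [hREL, hRIM]; linarith [hkey], hT, hpay, hinv, hwit⟩
  choose! Tf hTkey hTpair hTpay hTinv hTwit using hfam
  -- pairwise disjointness across roots: LEMMA X (shape form)
  have hdisj : ∀ r ∈ RT, ∀ r' ∈ RT, r ≠ r' → Disjoint (Tf r) (Tf r') := by
    intro r hr r' hr' hrr'
    rw [Finset.disjoint_left]
    intro bq hbq hbq'
    obtain ⟨κ, hκ, -, hmove⟩ := hTwit r hr bq hbq
    obtain ⟨κ', hκ', -, hmove'⟩ := hTwit r' hr' bq hbq'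
    obtain ⟨hlet, hch⟩ := word_letters_of_wf (huc r hr) (hWFc r hr) κ hκ
    obtain ⟨hlet', hch'⟩ := word_letters_of_wf (huc r' hr') (hWFc r' hr') κ' hκ'
    have hob := word_letters_oblique_of_wf (huc r hr) (hWFc r hr) κ hκ
    have hob' := word_letters_oblique_of_wf (huc r' hr') (hWFc r' hr') κ' hκ'
    rw [hu0 r hr] at hob
    rw [hu0 r' hr'] at hob'
    have hne' : r ≠ -r' := by
      intro h
      have h1 := hup r hr
      have h2 := hup r' hr'
      rw [h, map_neg, PiLp.neg_apply] at h1
      linarith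
    have hd : F κ (u r κ) = F κ (((-1 : ℝ) ^ κ.length) • r) := by rw [word_u_eq_pow (huc r hr) κ, hu0 r hr]
    have hd' : F κ' (u r' κ') = F κ' (((-1 : ℝ) ^ κ'.length) • r') := by
      rw [word_u_eq_pow (huc r' hr') κ', hu0 r' hr']
    exact word_target_ne_of_roots_ne_shape hFc hlet hlet' hch hch' (hRT r hr) (hRT r' hr') hrr' hne' hob hob'
      (neg_one_pow_eq_or ℝ κ.length) (neg_one_pow_eq_or ℝ κ'.length) hd hd'
      (shape_of_isEndMove hmove) (shape_of_isEndMove hmove') rfl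
  -- export the pooled pair set
  refine ⟨RT.biUnion Tf, ?_, ?_, ?_, ?_⟩
  · rw [card_biUnion hdisj]
    calc ∑ r ∈ RT, ((L r).filter fun p => -R₀ - 1 < (p + F [] r) 2 ∧ (p + F [] r) 2 < h + R₀ + 1).card
        ≤ ∑ r ∈ RT, ((Tf r).card + REL r + RIM) := sum_le_sum fun r hr => hTkey r hr
      _ = ∑ r ∈ RT, (Tf r).card + ∑ r ∈ RT, REL r + RT.card * RIM := by
          rw [sum_add_distrib, sum_add_distrib, sum_const, smul_eq_mul]
      _ ≤ _ := by rw [hREL, hRIM]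
  · intro bq hbq
    obtain ⟨r, hr, hbqr⟩ := mem_biUnion.1 hbq
    exact hTpair r hr bq hbqr
  · intro bq hbq
    obtain ⟨r, hr, hbqr⟩ := mem_biUnion.1 hbq
    exact hTpay r hr bq hbqr
  · intro bq hbq
    obtain ⟨r, hr, hbqr⟩ := mem_biUnion.1 hbq
    exact ⟨r, hr, hTinv r hr bq hbqr, hTwit r hr bq hbqr⟩

end MultiRootLaunch

end Summit.Ventures.Crystal3D.Theorems

end
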